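import Summits.AnomalousDissipation.AnomalousDissipation.Theorems.SolenoidalFractalHomogenisationLagrangianStepOneLevelDefsFamily
import HarnessLib

/-!
# K1L `LagrangianRenormalisationStep(Design)` (stmt-AnomalousDissipation-24912 → K1L_D): the SECTORIAL odd guard and the sectorial × defect window
# family — definitions and finite-dimensional algebra (helper; `--supports … --as helper`; LANDING LIST F1, part b)

Summits-side definitions file of route `SolenoidalFractalHomogenisation` (objects the K1L line posits + their elementary algebra; no named facts, no
sorry).  Landing item F1 (part b: §6 `OddSectorial` and its algebra `sector_add_aux` … `sector_inv`, `SectorialWindowClause`,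
`SectorialIntervalWindowClause`, `sectorialWindow_one`; §7 `SectorialIntervalWindowFamily`, p5's W5 in sectorial currency `SectorialOddChannelBound` with
`sectorialIntervalWindowClause_of_channelBound` / `sector_fix_of_gain_lt_one`) of the tenure planner's LANDING MAP (cell `ad-ideate`, tenure D24-2 (c) /
D24-3 «v2 window typing of record = defect family + SECTORIAL guard + W5 + stub_oneLevelL_I», STATUS 2026-08-28T13:04:46Z) for the crux workfile
`Cruxes/LagrangianRenormalisationStep/IntervalWindowFamilySketch.lean` (planner ad-ideate-p4 g9, commit 78e41dd75007, farm rc 0), texts copied VERBATIM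
into the shared namespace `…Theorems.SolenoidalFractalHomogenisation.LagrangianStep`.  Sibling of `…LagrangianStepOneLevelDefsFamily` (part a).

WHAT IS TYPED (p4 g9 amendment 1–2, answering p5 g6 §7 (b)).  The absolute odd-part guard `OddSmall S β` is amplified by the degree-(−1) response of
the one-level map (`κ_odd(bI) = γ_W/b²`); the scale-invariant replacement is the Kato-sector condition `OddSectorial S τ`:
`(β_S(k;p,q) − β_S(k;q,p))² ≤ τ²·σ_S(k,p)·σ_S(k,q)` — invariant under `S ↦ tS`, closed under positive sums / `renormStep`, EXACTLY preserved by block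
inversion (`sector_inv`), convertible both ways against `NearIso` (`OddSectorial.oddSmall`, `oddSectorial_of_oddSmall`).  The clause of record is
`SectorialIntervalWindowClause Φν S⋆ slo shi λ₀ Λ τlo τhi μ` and the package `SectorialIntervalWindowFamily`; the odd half of the clause follows from a
sectorial odd-channel bound with gain `κ < 1` and source `ε` once `τlo ≥ ε/(1−κ)` (`sector_fix_of_gain_lt_one`; numbers of record for the cubature
word: κ ≈ 0.51 on the ray, ≤ 0.583 anisotropic — p5 j308758, p4 j308857).  Infrastructure for route-1's rung leaf F-D1.A0 (a frontier FORMAL rung);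
NOT a proof of the crux, of Onsager's conjecture or of anomalous dissipation.  Landed by prover seat `ad-k3l-bookkeeping-p1` g3, 2026-08-28.
-/

set_option linter.dupNamespace false

namespace Summit.AnomalousDissipation.AnomalousDissipation.Theorems.SolenoidalFractalHomogenisation.LagrangianStep

open Literature.Analysis Literature.Analysis.FluidPDE Literature.Analysis.FunctionSpaces
open MeasureTheory Set Filter
open scoped ENNReal NNReal InnerProductSpace

noncomputable section

/-! ## §6 The SECTORIAL odd guard (Kato sector), its algebra, the sectorial window clauses -/

/-- **SECTORIAL ODD-PART BOUND** (Kato sector of half-angle `arctan τ` for every transverse block): the antisymmetric part of the transverse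
bilinear symbol is at most `τ` times the GEOMETRIC MEAN of the even symbol at `p` and at `q`.  Scale-invariant, unlike `OddSmall`. -/
def OddSectorial (S : T4) (τ : ℝ) : Prop :=
  ∀ k p q : Fin 3 → ℝ, ∑ i, p i * k i = 0 → ∑ i, q i * k i = 0 →
    (Torus.bsymb S k p q - Torus.bsymb S k q p) ^ 2 ≤ τ ^ 2 * (Torus.symb S k p * Torus.symb S k q)

/-- The real-number core of `OddSectorial.add`: two sectorial forms add (Cauchy–Schwarz / AM–GM on the cross term). -/
theorem sector_add_aux {x y a₁ a₂ b₁ b₂ τ : ℝ} (ha₁ : 0 ≤ a₁) (ha₂ : 0 ≤ a₂) (hb₁ : 0 ≤ b₁) (hb₂ : 0 ≤ b₂)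
    (h₁ : x ^ 2 ≤ τ ^ 2 * (a₁ * a₂)) (h₂ : y ^ 2 ≤ τ ^ 2 * (b₁ * b₂)) :
    (x + y) ^ 2 ≤ τ ^ 2 * ((a₁ + b₁) * (a₂ + b₂)) := by
  have hM : 0 ≤ τ ^ 2 * (a₁ * b₂ + a₂ * b₁) := mul_nonneg (sq_nonneg τ) (add_nonneg (mul_nonneg ha₁ hb₂) (mul_nonneg ha₂ hb₁))
  have hsq : (2 * (x * y)) ^ 2 ≤ (τ ^ 2 * (a₁ * b₂ + a₂ * b₁)) ^ 2 := by
    have hprod : x ^ 2 * y ^ 2 ≤ (τ ^ 2 * (a₁ * a₂)) * (τ ^ 2 * (b₁ * b₂)) :=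
      mul_le_mul h₁ h₂ (sq_nonneg _) (mul_nonneg (sq_nonneg τ) (mul_nonneg ha₁ ha₂))
    have hamgm : 4 * ((a₁ * a₂) * (b₁ * b₂)) ≤ (a₁ * b₂ + a₂ * b₁) ^ 2 := by
      nlinarith [sq_nonneg (a₁ * b₂ - a₂ * b₁)]
    have hτ4 : 0 ≤ (τ ^ 2) ^ 2 := sq_nonneg _
    calc (2 * (x * y)) ^ 2 = 4 * (x ^ 2 * y ^ 2) := by ring
      _ ≤ 4 * ((τ ^ 2 * (a₁ * a₂)) * (τ ^ 2 * (b₁ * b₂))) := by linarith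
      _ = (τ ^ 2) ^ 2 * (4 * ((a₁ * a₂) * (b₁ * b₂))) := by ring
      _ ≤ (τ ^ 2) ^ 2 * (a₁ * b₂ + a₂ * b₁) ^ 2 := mul_le_mul_of_nonneg_left hamgm hτ4
      _ = (τ ^ 2 * (a₁ * b₂ + a₂ * b₁)) ^ 2 := by ring
  have hcross : 2 * (x * y) ≤ τ ^ 2 * (a₁ * b₂ + a₂ * b₁) := (abs_le_of_sq_le_sq' hsq hM).2
  calc (x + y) ^ 2 = x ^ 2 + y ^ 2 + 2 * (x * y) := by ring
    _ ≤ τ ^ 2 * (a₁ * a₂) + τ ^ 2 * (b₁ * b₂) + τ ^ 2 * (a₁ * b₂ + a₂ * b₁) := by linarith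
    _ = τ ^ 2 * ((a₁ + b₁) * (a₂ + b₂)) := by ring

/-- SCALE INVARIANCE: the sector is kept by EVERY real multiple (both sides scale by `c²`). -/
theorem OddSectorial.smul {S : T4} {τ : ℝ} (h : OddSectorial S τ) (c : ℝ) : OddSectorial (c • S) τ := by
  intro k p q hp hq
  have h' := h k p q hp hq
  rw [Torus.bsymb_smul, Torus.bsymb_smul, Torus.symb_smul, Torus.symb_smul]
  calc (c * Torus.bsymb S k p q - c * Torus.bsymb S k q p) ^ 2 = c ^ 2 * (Torus.bsymb S k p q - Torus.bsymb S k q p) ^ 2 := by ring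
    _ ≤ c ^ 2 * (τ ^ 2 * (Torus.symb S k p * Torus.symb S k q)) := mul_le_mul_of_nonneg_left h' (sq_nonneg c)
    _ = τ ^ 2 * (c * Torus.symb S k p * (c * Torus.symb S k q)) := by ring

/-- … so the `ν`-scaling of the cell laws costs nothing: `OddSectorial ((1/ν)•𝔸) τ ↔ OddSectorial 𝔸 τ`. -/
theorem oddSectorial_smul_iff {S : T4} {τ c : ℝ} (hc : c ≠ 0) : OddSectorial (c • S) τ ↔ OddSectorial S τ := by
  refine ⟨fun h => ?_, fun h => h.smul c⟩
  have h' := h.smul c⁻¹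
  rwa [smul_smul, inv_mul_cancel₀ hc, one_smul] at h'

/-- The sector widens monotonically in `τ ≥ 0` (transversally nonnegative tensors). -/
theorem OddSectorial.mono {S : T4} {τ τ' : ℝ} (h : OddSectorial S τ) (hpos : TransNonneg S) (hτ : 0 ≤ τ) (hle : τ ≤ τ') :
    OddSectorial S τ' := by
  intro k p q hp hq
  refine (h k p q hp hq).trans (mul_le_mul_of_nonneg_right (pow_le_pow_left₀ hτ hle 2) ?_)
  exact mul_nonneg (hpos k p hp) (hpos k q hq)

/-- SUMS: two transversally nonnegative tensors in the sector `τ` add to a tensor in the sector `τ` (sectors are convex cones). -/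
theorem OddSectorial.add {A B : T4} {τ : ℝ} (hA : OddSectorial A τ) (hB : OddSectorial B τ)
    (hApos : TransNonneg A) (hBpos : TransNonneg B) : OddSectorial (A + B) τ := by
  intro k p q hp hq
  rw [Torus.bsymb_add, Torus.bsymb_add, Torus.symb_add, Torus.symb_add]
  have e : Torus.bsymb A k p q + Torus.bsymb B k p q - (Torus.bsymb A k q p + Torus.bsymb B k q p) =
      (Torus.bsymb A k p q - Torus.bsymb A k q p) + (Torus.bsymb B k p q - Torus.bsymb B k q p) := by ring
  rw [e]
  exact sector_add_aux (hApos k p hp) (hApos k q hq) (hBpos k p hp) (hBpos k q hq) (hA k p q hp hq) (hB k p q hp hq)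

/-- The scalar viscosity has no odd part: it lies in every sector. -/
theorem oddSectorial_isoVisc (ν τ : ℝ) : OddSectorial (Torus.isoVisc ν : T4) τ := by
  intro k p q hp hq
  have hpq : ∑ i, p i * q i = ∑ i, q i * p i := Finset.sum_congr rfl fun i _ => mul_comm _ _
  rw [Torus.bsymb_isoVisc, Torus.bsymb_isoVisc, hpq, sub_self, Torus.symb_isoVisc, Torus.symb_isoVisc]
  have : 0 ≤ τ ^ 2 * (ν * ((∑ a, k a ^ 2) * ∑ i, p i ^ 2) * (ν * ((∑ a, k a ^ 2) * ∑ i, q i ^ 2))) := by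
    have h0 : 0 ≤ ν * ((∑ a, k a ^ 2) * ∑ i, p i ^ 2) * (ν * ((∑ a, k a ^ 2) * ∑ i, q i ^ 2)) := by
      have : ν * ((∑ a, k a ^ 2) * ∑ i, p i ^ 2) * (ν * ((∑ a, k a ^ 2) * ∑ i, q i ^ 2)) =
          ν ^ 2 * (((∑ a, k a ^ 2) * ∑ i, p i ^ 2) * ((∑ a, k a ^ 2) * ∑ i, q i ^ 2)) := by ring
      rw [this]; positivity
    exact mul_nonneg (sq_nonneg τ) h0
  simpa using this

/-- `renormStep` keeps the sector (convex combination of two transversally nonnegative tensors in the sector). -/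
theorem oddSectorial_renormStep {Φν : T4 → T4} {τ g : ℝ} (hg : 0 ≤ g) {S : T4}
    (hSpos : TransNonneg S) (hΦpos : TransNonneg (Φν S)) (hS : OddSectorial S τ) (hΦ : OddSectorial (Φν S) τ) :
    OddSectorial (renormStep Φν g S) τ :=
  ((hS.add (hΦ.smul g) hSpos (hΦpos.smul hg))).smul (1 / (1 + g))

/-- CONVERSION sector → absolute: `OddSectorial τ ∧ NearIso lo hi` (`lo ≥ 0`, `τ ≥ 0`) gives `OddSmall (τ·hi)` — how the chain feeds the
UNCHANGED absolute `OddSmall S β` hypotheses of `stub_oneLevelL_I` / (V). -/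
theorem OddSectorial.oddSmall {S : T4} {τ lo hi : ℝ} (h : OddSectorial S τ) (hn : Torus.NearIso S lo hi) (hlo : 0 ≤ lo) (_hτ : 0 ≤ τ) :
    Torus.OddSmall S (τ * hi) := by
  intro k p q hp hq
  obtain ⟨hlp, hhp⟩ := hn k p hp
  obtain ⟨hlq, hhq⟩ := hn k q hq
  have hQp : 0 ≤ (∑ a, k a ^ 2) * (∑ i, p i ^ 2) := by positivity
  have hQq : 0 ≤ (∑ a, k a ^ 2) * (∑ i, q i ^ 2) := by positivity
  have hσp : 0 ≤ Torus.symb S k p := le_trans (mul_nonneg hlo hQp) hlp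
  have hσq : 0 ≤ Torus.symb S k q := le_trans (mul_nonneg hlo hQq) hlq
  have hHp : 0 ≤ hi * ((∑ a, k a ^ 2) * (∑ i, p i ^ 2)) := hσp.trans hhp
  calc (Torus.bsymb S k p q - Torus.bsymb S k q p) ^ 2 ≤ τ ^ 2 * (Torus.symb S k p * Torus.symb S k q) := h k p q hp hq
    _ ≤ τ ^ 2 * ((hi * ((∑ a, k a ^ 2) * (∑ i, p i ^ 2))) * (hi * ((∑ a, k a ^ 2) * (∑ i, q i ^ 2)))) :=
        mul_le_mul_of_nonneg_left (mul_le_mul hhp hhq hσq hHp) (sq_nonneg τ)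
    _ = (τ * hi) ^ 2 * ((∑ a, k a ^ 2) ^ 2 * ((∑ i, p i ^ 2) * (∑ i, q i ^ 2))) := by ring

/-- CONVERSION absolute → sector: `OddSmall β ∧ NearIso lo hi` (`lo > 0`) gives `OddSectorial (β/lo)` — how F2 feeds (V)'s absolute hypothesis
`OddSmall 𝔸 (ν·β)` into the sectorial window. -/
theorem oddSectorial_of_oddSmall {S : T4} {β lo hi : ℝ} (h : Torus.OddSmall S β) (hn : Torus.NearIso S lo hi) (hlo : 0 < lo) :
    OddSectorial S (β / lo) := by
  intro k p q hp hq
  obtain ⟨hlp, _⟩ := hn k p hp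
  obtain ⟨hlq, _⟩ := hn k q hq
  have hQp : 0 ≤ (∑ a, k a ^ 2) * (∑ i, p i ^ 2) := by positivity
  have hQq : 0 ≤ (∑ a, k a ^ 2) * (∑ i, q i ^ 2) := by positivity
  have hlo0 : lo ≠ 0 := hlo.ne'
  calc (Torus.bsymb S k p q - Torus.bsymb S k q p) ^ 2 ≤ β ^ 2 * ((∑ a, k a ^ 2) ^ 2 * ((∑ i, p i ^ 2) * (∑ i, q i ^ 2))) := h k p q hp hq
    _ = (β / lo) ^ 2 * ((lo * ((∑ a, k a ^ 2) * (∑ i, p i ^ 2))) * (lo * ((∑ a, k a ^ 2) * (∑ i, q i ^ 2)))) := by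
        field_simp
    _ ≤ (β / lo) ^ 2 * (Torus.symb S k p * Torus.symb S k q) :=
        mul_le_mul_of_nonneg_left (mul_le_mul hlp hlq (mul_nonneg hlo.le hQq) (le_trans (mul_nonneg hlo.le hQp) hlp)) (sq_nonneg _)

/-- **THE CERTIFICATE OF THE LEVER (finite-dimensional core): INVERSION PRESERVES THE SECTOR EXACTLY.**  For an invertible real matrix `B`,
the sector condition `(xᵀBy − yᵀBx)² ≤ τ²(xᵀBx)(yᵀBy)` (all `x, y`) passes to `B⁻¹` with the SAME `τ` (substitute `x = Bx₀`, `y = By₀`: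
`xᵀB⁻¹y = y₀ᵀBx₀`, `xᵀB⁻¹x = x₀ᵀBx₀`; Kato: `W(B⁻¹) = conj W(B)` up to positive scaling).  A degree-(−1) slot response therefore does NOT amplify
the sectorial odd part — contrast the absolute gain `γ_W/b²`. [folklore; Kato, Perturbation Theory, V §3.10] -/
theorem sector_inv {n : ℕ} (B : Matrix (Fin n) (Fin n) ℝ) (hB : IsUnit B.det) {τ : ℝ}
    (h : ∀ x y : Fin n → ℝ, (x ⬝ᵥ B.mulVec y - y ⬝ᵥ B.mulVec x) ^ 2 ≤ τ ^ 2 * ((x ⬝ᵥ B.mulVec x) * (y ⬝ᵥ B.mulVec y))) :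
    ∀ x y : Fin n → ℝ, (x ⬝ᵥ B⁻¹.mulVec y - y ⬝ᵥ B⁻¹.mulVec x) ^ 2 ≤ τ ^ 2 * ((x ⬝ᵥ B⁻¹.mulVec x) * (y ⬝ᵥ B⁻¹.mulVec y)) := by
  intro x y
  set x₀ : Fin n → ℝ := B⁻¹.mulVec x with hx₀
  set y₀ : Fin n → ℝ := B⁻¹.mulVec y with hy₀
  have hx : B.mulVec x₀ = x := by rw [hx₀, Matrix.mulVec_mulVec, Matrix.mul_nonsing_inv _ hB, Matrix.one_mulVec]
  have hy : B.mulVec y₀ = y := by rw [hy₀, Matrix.mulVec_mulVec, Matrix.mul_nonsing_inv _ hB, Matrix.one_mulVec]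
  have e1 : x ⬝ᵥ y₀ = y₀ ⬝ᵥ B.mulVec x₀ := by rw [← hx, dotProduct_comm]
  have e2 : y ⬝ᵥ x₀ = x₀ ⬝ᵥ B.mulVec y₀ := by rw [← hy, dotProduct_comm]
  have e3 : x ⬝ᵥ x₀ = x₀ ⬝ᵥ B.mulVec x₀ := by rw [← hx, dotProduct_comm]
  have e4 : y ⬝ᵥ y₀ = y₀ ⬝ᵥ B.mulVec y₀ := by rw [← hy, dotProduct_comm]
  rw [e1, e2, e3, e4]
  calc (y₀ ⬝ᵥ B.mulVec x₀ - x₀ ⬝ᵥ B.mulVec y₀) ^ 2 = (x₀ ⬝ᵥ B.mulVec y₀ - y₀ ⬝ᵥ B.mulVec x₀) ^ 2 := by ring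
    _ ≤ τ ^ 2 * ((x₀ ⬝ᵥ B.mulVec x₀) * (y₀ ⬝ᵥ B.mulVec y₀)) := h x₀ y₀

/-- **SECTORIAL WINDOW CLAUSE** (I-centred): the tree's `WindowClause Φ lo hi Λ β` with the absolute odd guard replaced by the sector, for
every half-angle `τ ∈ [τlo, τhi]`.  Family use: `∀ ν, SectorialWindowClause (Φ ν) lo hi Λ τlo τhi`. -/
def SectorialWindowClause (Φν : T4 → T4) (lo hi Λ τlo τhi : ℝ) : Prop :=
  ∀ τ ∈ Set.Icc τlo τhi, ∀ lam ∈ Set.Icc (1:ℝ) Λ, ∀ S : T4, OddSectorial S τ → Torus.NearIso S (lo / lam) (hi * lam) →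
    OddSectorial (Φν S) τ ∧ Torus.NearIso (Φν S) (lo / lam) (hi * lam)

/-- **SECTORIAL INTERVAL WINDOW CLAUSE** (S⋆-centred; §2 with the sector in place of `OddSmall`): both guards are scale-free cones — a Thompson
ball for the even part, a Kato sector for the odd part.  (§3–§5 transfer verbatim with `OddSmall β ↦ OddSectorial τ` and the conversion
`OddSectorial.oddSmall`; not re-proved here.) -/
def SectorialIntervalWindowClause (Φν : T4 → T4) (Sstar : T4) (slo shi lam₀ Λ τlo τhi μ : ℝ) : Prop :=
  Torus.NearIso Sstar slo shi ∧ 1 ≤ lam₀ ∧ InInterval Sstar lam₀ (Torus.isoVisc 1) ∧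
  ∀ τ ∈ Set.Icc τlo τhi, ∀ lam ∈ Set.Icc lam₀ Λ, ∀ S : T4, OddSectorial S τ → InInterval Sstar lam S →
    OddSectorial (Φν S) τ ∧ InInterval Sstar (μ * lam) (Φν S)

/-- The clause at `λ = 1`. -/
theorem sectorialWindow_one {Φν : T4 → T4} {lo hi Λ τlo τhi τ : ℝ} (hwin : SectorialWindowClause Φν lo hi Λ τlo τhi) (hΛ : 1 ≤ Λ)
    (hτ : τ ∈ Set.Icc τlo τhi) {S : T4} (hSo : OddSectorial S τ) (hSn : Torus.NearIso S lo hi) :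
    OddSectorial (Φν S) τ ∧ Torus.NearIso (Φν S) lo hi := by
  have h1 : (1:ℝ) ∈ Set.Icc (1:ℝ) Λ := ⟨le_rfl, hΛ⟩
  obtain ⟨ho, hn⟩ := hwin τ hτ 1 h1 S hSo (by simpa using hSn)
  exact ⟨ho, by simpa using hn⟩

/-- **THE SECTORIAL INTERVAL WINDOW PACKAGE for the family** — `IntervalWindowFamily`'s eleven conjuncts with the sectorial clause, plus the four
sector bookkeeping facts: chain sector `τc ∈ [τlo, τhi]`, `τc ≥ 0`, `τc·hi ≤ β` (feeds the absolute `OddSmall S β` of `stub_oneLevelL_I` / (T) / (L)),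
and the F2 sector `β·ΛV/lo ∈ [τlo, τhi]`. -/
def SectorialIntervalWindowFamily (Φ : ℝ → T4 → T4) (μ : ℝ → ℝ) (Sstar : T4)
    (slo shi lam₀ Λ Λc Λ' τlo τhi τc β lo hi ΛV : ℝ) : Prop :=
  (∀ ν, SectorialIntervalWindowClause (Φ ν) Sstar slo shi lam₀ Λ τlo τhi (μ ν)) ∧ (∀ ν, 1 ≤ μ ν) ∧ TailDefectBound μ lam₀ Λc ∧
  0 < slo ∧ lam₀ ≤ Λc ∧ Λc ≤ Λ ∧ lo * Λc ≤ slo ∧ shi * Λc ≤ hi ∧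
  Λ' ∈ Set.Icc lam₀ Λ ∧ ΛV * shi ≤ Λ' * lo ∧ ΛV * hi ≤ Λ' * slo ∧
  τc ∈ Set.Icc τlo τhi ∧ 0 ≤ τc ∧ τc * hi ≤ β ∧ β * ΛV / lo ∈ Set.Icc τlo τhi

/-- SECTORIAL GAIN-PLUS-SOURCE BOUND (the sector analogue of p5's W5 `OddChannelBound Φ lo hi Λ κ ε`, CellLawVPlanSketch v3): on the interval of
aspect `λ ∈ [λ₀, Λ]` the map shrinks the sector by the factor `κ` up to a source `ε` (numbers of record: `κ ≤ 0.62 < 1` for `DΦ_{W₀}` over aspects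
≤ 57; `ε` = the ν-uniform mixing residue in sector units, positive for the non-reversal-symmetric cubature word — p5 12:45:20Z (1)). -/
def SectorialOddChannelBound (Φν : T4 → T4) (Sstar : T4) (lam₀ Λ κ ε : ℝ) : Prop :=
  ∀ lam ∈ Set.Icc lam₀ Λ, ∀ S : T4, ∀ τ : ℝ, 0 ≤ τ → InInterval Sstar lam S → OddSectorial S τ → OddSectorial (Φν S) (κ * τ + ε)

/-- **The odd half of `SectorialIntervalWindowClause` from gain + source.**  If `κ, ε ≥ 0`, `κ·τ + ε ≤ τ` for `τ ∈ [τlo, τhi]` (for `κ < 1`: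
`τlo ≥ ε/(1-κ)`), `τlo ≥ 0`, and the EVEN half holds (it may use the sector hypothesis), then the full clause holds. -/
theorem sectorialIntervalWindowClause_of_channelBound {Φν : T4 → T4} {Sstar : T4} {slo shi lam₀ Λ τlo τhi μ κ ε : ℝ}
    (hstar : Torus.NearIso Sstar slo shi) (hslo : 0 ≤ slo) (hlam₀ : 1 ≤ lam₀) (hiso : InInterval Sstar lam₀ (Torus.isoVisc 1)) (hμ : 1 ≤ μ)
    (hκ : 0 ≤ κ) (hε : 0 ≤ ε) (hτlo : 0 ≤ τlo) (hfix : ∀ τ ∈ Set.Icc τlo τhi, κ * τ + ε ≤ τ)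
    (hodd : SectorialOddChannelBound Φν Sstar lam₀ Λ κ ε)
    (heven : ∀ τ ∈ Set.Icc τlo τhi, ∀ lam ∈ Set.Icc lam₀ Λ, ∀ S : T4, OddSectorial S τ → InInterval Sstar lam S →
      InInterval Sstar (μ * lam) (Φν S)) :
    SectorialIntervalWindowClause Φν Sstar slo shi lam₀ Λ τlo τhi μ := by
  refine ⟨hstar, hlam₀, hiso, fun τ hτ lam hlam S hSo hSi => ?_⟩
  have hΦi := heven τ hτ lam hlam S hSo hSi
  have hτ0 : 0 ≤ τ := hτlo.trans hτ.1
  have hlam1 : 1 ≤ lam := hlam₀.trans hlam.1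
  have hμlam1 : 1 ≤ μ * lam := one_le_mul_of_one_le_of_one_le hμ hlam1
  have hΦnn : TransNonneg (Φν S) :=
    transNonneg_of_nearIso (InInterval.nearIso hμlam1 hstar hΦi) (div_nonneg hslo (zero_le_one.trans hμlam1))
  have h := hodd lam hlam S τ hτ0 hSi hSo
  exact ⟨h.mono hΦnn (by positivity) (hfix τ hτ), hΦi⟩

/-- The fixed-point inequality of the previous theorem from `0 ≤ κ < 1` and `τlo ≥ ε/(1-κ)` (p5's `β ≥ ε/(1-κ)` in sector units). -/
theorem sector_fix_of_gain_lt_one {κ ε τlo τhi : ℝ} (hκ1 : κ < 1) (hτlo : ε / (1 - κ) ≤ τlo) :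
    ∀ τ ∈ Set.Icc τlo τhi, κ * τ + ε ≤ τ := by
  intro τ hτ
  have h1 : 0 < 1 - κ := by linarith
  have h2 : ε ≤ (1 - κ) * τ := by
    rw [div_le_iff₀ h1] at hτlo
    nlinarith [hτ.1]
  nlinarith

end

end Summit.AnomalousDissipation.AnomalousDissipation.Theorems.SolenoidalFractalHomogenisation.LagrangianStep
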